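import Summits.HodgeConjecture.HodgeConjecture.Theorems.F0P3bCentralCharacterUnitaryNonsplit   -- ★ `exists_centralChar_norm_eq_one_of_nonsplit` (+ ★ `F0P3bLocalNonsplitCompactCenter` template lemmas)
import Literature.NumberTheory.Automorphic.CMBorelWeylTorusConjugate                          -- ★ `glDiagonal_rev_eq_weylConj`, `weylConj_mem_torusU`, `torusEntry_zero_weylConj`, …
import Literature.NumberTheory.Automorphic.CMLocalNonsplitBorelTransport                      -- ★ `mem_range_glDiagonal_iff_isDiag`
import Literature.NumberTheory.Automorphic.QuotientCharacterEigenvector                         -- ★ (D2) `hasJacquetExponent_of_quotient_character`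
import Literature.NumberTheory.Automorphic.U3PrincipalSeriesLettersUnfold                       -- ★ `U3SquareIntegrableExponents_iff`
import Literature.NumberTheory.Automorphic.U3PrincipalSeriesJacquetFiltrationUnfold             -- ★ `finiteDimensional_finrank_eq_two_of_U3PrincipalSeriesJacquetFiltration`
import Literature.NumberTheory.Automorphic.JacquetModuleExactProofs                             -- ★ `jacquetMap_injective`
import Literature.NumberTheory.Automorphic.UnitaryGroupUnipotentLimitCompactOpen                -- ★ `isLimitOfCompactOpen_cmBorelTriple_N`
import Literature.NumberTheory.Rogawski1990.U3SquareIntegrabilityExponentCriterion              -- ★ #110 `u3_squareIntegrable_jacquetExponent_decay` (the letter proved here)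
import Summits.HodgeConjecture.HodgeConjecture.Theorems.F0P3JacquetEmbeddingDichotomy            -- ★ `exists_injective_intertwiningMap_cmPrincipalSeries`
import Summits.HodgeConjecture.HodgeConjecture.Theorems.F0P3U3PrincipalSeriesJacquetFiltrationHolds  -- ★ N1 `U3PrincipalSeriesJacquetFiltration_holds`
import Summits.HodgeConjecture.HodgeConjecture.Theorems.F0P3U3LengthLeTwoOfEmbeds                -- ★ `isSmooth_cmPrincipalSeries`
import Summits.HodgeConjecture.HodgeConjecture.Theorems.F0P2oBorelTorusModulus                   -- ★ `rootDeltaChar_cmBorel_torus`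
import Summits.HodgeConjecture.HodgeConjecture.Theorems.F0P3U3PrincipalSeriesOpenCellTorusChar   -- ★ `exists_weylElt_three`
import Summits.HodgeConjecture.HodgeConjecture.Theorems.F0P3U3SquareIntegrableExponentsHolds   -- ★ N5 #109 `u3SquareIntegrableExponents_holds` (p834912, hypothesis-free)
import HarnessLib

/-!
# #110 ⇐ #109: Casselman's criterion (⇒) for `U(Φ₃)(L⁺_v)` in the Borel–Jacquet-QUOTIENT typing, derived from the EXPONENT typing
# (Casselman 1995 Thm. 4.4.6; Kato–Takano 2009 p. 3; Rogawski 1990 §12.2)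

Cell `hodgecm-mathlib`, crux H413, programme P2 (topic T7, node N7) ∕ P3b (node N5).  THEOREMS ONLY (no `def`, no instance, no `sorry`; axioms
TRIO).  The director's ADAPTER ROW (s677): the tree types [Casselman1995, Thm. 4.4.6] twice —
* #109 ★ `UnitaryGroup.U3SquareIntegrableExponents L` (P3b, an `iff` over the EIGEN-exponents `HasJacquetExponent` of the normalised Jacquet module,
  the cone read on the split torus `a = d(a₀, 1, a₀⁻¹)`, `σ a₀ = a₀`), and
* #110 ★ `Rogawski1990.u3_squareIntegrable_jacquetExponent_decay` (P2, the (⇒) half over one-dimensional QUOTIENTS `π_N → ℂ_χ` of the unnormalised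
  Jacquet module, the cone read on ALL of `T`: `‖χ t‖ < ‖t₀₀‖` whenever `‖t₀₀‖ < 1`),
and this file proves **#110 from #109** (`u3_squareIntegrable_jacquetExponent_decay_of_exponents`) and, #109 being PROVED IN THE TREE
hypothesis-free (★ `F0P3U3SquareIntegrableExponentsHolds.u3SquareIntegrableExponents_holds`, p834912), **#110 OUTRIGHT**
(`u3_squareIntegrable_jacquetExponent_decay_holds`).

## The dictionary
* (D1) central character: an irreducible admissible `π` of `U(Φ₃)(L⁺_v)`, `v` non-split, has a unitary central character (★
  `F0P3bCentralCharacterUnitaryNonsplit.exists_centralChar_norm_eq_one_of_nonsplit`).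
* (D2) quotient ⇒ eigen: a non-zero `T`-map `π_N → ℂ_χ` gives the normalised exponent `χ·δ_B^{-1∕2}` (★ `Representation.hasJacquetExponent_of_quotient_character`,
  `T` abelian ★ `torusU_mul_comm`), `π_N` being finite-dimensional because `π` embeds into a principal series whose Jacquet module is `2`-dimensional
  (`finiteDimensional_coinvariants_of_irreducible`: ★ `F0P3JacquetEmbeddingDichotomy`, ★ `jacquetMap_injective`, ★ N1).
* (D3) `δ_B^{1∕2}(a) = ‖a₀₀‖` on the torus (★ `F0P2oBorelTorusModulus.rootDeltaChar_cmBorel_torus`).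
* (D4) cone reduction `T ⇝ A⁻`: for `t = diag(d₀, d₁, d₂) ∈ T` and the Weyl element `w₀` (★ `exists_weylElt_three`), `ʷt = diag(d₂, d₁, d₀)`; the split part
  `a := t·(ʷt)⁻¹ = diag(d₀σ(d₀), 1, ·)` lies in #109's cone with `‖a₀₀‖ = ‖t₀₀‖²` (`splitPart_entries`), and the unit part `k := t·ʷt` has all entries of
  valuation `1`, hence lies in the compact level `U(Φ₃)(𝒪_v)` together with all its powers, so `‖χ k‖ = 1` for the continuous `χ`
  (`norm_apply_mul_weylConj_eq_one`, via §1–§2); then `‖χ t‖² = ‖χ a‖·‖χ k‖ = ‖χ a‖ < δ_B^{1∕2}(a) = ‖t₀₀‖²`.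

HC_CM is proved only modulo the printed citations until rung 0 closes; this file closes the printed letter #110 in the tree (via ★ #109).

## References
* [Casselman1995] W. Casselman, *Introduction to the theory of admissible representations of p-adic reductive groups* (1995 notes), Thm. 4.4.6 p. 45,
  §1.4 p. 13, §4.4, Prop. 2.1.9.
* [KatoTakano2009] S. Kato, K. Takano, *Square integrability of representations on p-adic symmetric spaces*, IMRN 2010 (arXiv:0902.2302), p. 3.
* [Rogawski1990] J. D. Rogawski, *Automorphic Representations of Unitary Groups in Three Variables*, Ann. of Math. Stud. 123 (1990), §1.10 p. 9, §12.2
  pp. 173–174.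
* [BernsteinZelevinsky1977] I. N. Bernstein, A. V. Zelevinsky, *Induced representations of reductive p-adic groups I*, Ann. sci. ÉNS 10 (1977), §2.3.
* [PlatonovRapinchuk1994] V. Platonov, A. Rapinchuk, *Algebraic Groups and Number Theory* (1994), §3.3, §5.1.
-/

set_option autoImplicit false
set_option linter.dupNamespace false

noncomputable section

open NumberField IsDedekindDomain
open Literature.NumberTheory.Automorphic Literature.NumberTheory.Automorphic.UnitaryGroup Literature.NumberTheory.Rogawski1990
open scoped Matrix MatrixGroups NNReal

namespace Summit.HodgeConjecture.HodgeConjecture.Cruxes.H413.F0P2oN7OfCasselmanCriterion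

/-! ## §1 A continuous character is unitary on an element whose powers stay in a compact set -/

section Generic

/-- **Unitarity on the compact part.**  `T ≤ G` a closed subgroup of a topological group, `χ : T →* ℂˣ` continuous, `C ⊆ G` compact; if all
powers of `k ∈ T` and of `k⁻¹` lie in `C`, then `‖χ k‖ = 1` (`‖χ‖` is bounded on the compact `T ∩ C`, and `n ↦ ‖χ k‖^{±n}` stays there).
[cite: Casselman1995, §4.4 proof of Thm. 4.4.6] [cite: BernsteinZelevinsky1976, §2.10] -/
theorem norm_apply_eq_one_of_pow_mem_isCompact {G : Type*} [Group G] [TopologicalSpace G] [IsTopologicalGroup G]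
    (T : Subgroup G) (hT : IsClosed (T : Set G)) (χ : ↥T →* ℂˣ) (hχ : Continuous fun t : ↥T => ((χ t : ℂˣ) : ℂ))
    {C : Set G} (hC : IsCompact C) (k : ↥T) (hk : ∀ n : ℕ, ((k ^ n : ↥T) : G) ∈ C) (hk' : ∀ n : ℕ, ((k⁻¹ ^ n : ↥T) : G) ∈ C) :
    ‖((χ k : ℂˣ) : ℂ)‖ = 1 := by
  have hC' : IsCompact ((Subtype.val : ↥T → G) ⁻¹' C) := hT.isClosedEmbedding_subtypeVal.isCompact_preimage hC
  obtain ⟨M, hM⟩ := hC'.exists_bound_of_continuousOn hχ.continuousOn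
  have hb : ∀ n : ℕ, ‖((χ k : ℂˣ) : ℂ)‖ ^ n ≤ M := fun n => by
    rw [← norm_pow, ← Units.val_pow_eq_pow_val, ← map_pow]
    exact hM _ (hk n)
  have hb' : ∀ n : ℕ, ‖((χ k : ℂˣ) : ℂ)‖⁻¹ ^ n ≤ M := fun n => by
    rw [← norm_inv, ← Units.val_inv_eq_inv_val, ← map_inv, ← norm_pow, ← Units.val_pow_eq_pow_val, ← map_pow]
    exact hM _ (hk' n)
  have h1 : ‖((χ k : ℂˣ) : ℂ)‖ ≤ 1 := le_of_not_gt fun h => by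
    obtain ⟨n, hn⟩ := pow_unbounded_of_one_lt M h
    exact (hb n).not_gt hn
  have hpos : 0 < ‖((χ k : ℂˣ) : ℂ)‖ := norm_pos_iff.2 (χ k).ne_zero
  have h2 : ‖((χ k : ℂˣ) : ℂ)‖⁻¹ ≤ 1 := le_of_not_gt fun h => by
    obtain ⟨n, hn⟩ := pow_unbounded_of_one_lt M h
    exact (hb' n).not_gt hn
  exact le_antisymm h1 ((inv_le_one₀ hpos).1 h2)

/-- **The diagonal torus `T ≤ U(σ, J)(R)` is closed** (`T₁` topological ring `R`): `T` is the preimage of the diagonal matrices (★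
`mem_range_glDiagonal_iff_isDiag`), an intersection of zero sets of the continuous entry maps. [cite: PlatonovRapinchuk1994, §3.3] -/
theorem isClosed_torusU {R : Type*} [CommRing R] [TopologicalSpace R] [IsTopologicalRing R] [T1Space R] (σ : R →+* R) {N : ℕ}
    (J : Matrix (Fin N) (Fin N) R) : IsClosed (torusU σ J : Set ↥(unitaryGroupOfForm σ J)) := by
  have h : IsClosed {g : GL (Fin N) R | ∀ i j : Fin N, i ≠ j → ((g : GL (Fin N) R) : Matrix (Fin N) (Fin N) R) i j = 0} := by
    have hset : {g : GL (Fin N) R | ∀ i j : Fin N, i ≠ j → ((g : GL (Fin N) R) : Matrix (Fin N) (Fin N) R) i j = 0} =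
        ⋂ i : Fin N, ⋂ j : Fin N, ⋂ (_ : i ≠ j), {g : GL (Fin N) R | ((g : GL (Fin N) R) : Matrix (Fin N) (Fin N) R) i j = 0} := by
      ext g
      simp only [Set.mem_setOf_eq, Set.mem_iInter]
    rw [hset]
    exact isClosed_iInter fun i => isClosed_iInter fun j => isClosed_iInter fun _ =>
      isClosed_eq (Units.continuous_val.matrix_elem i j) continuous_const
  have hset : (torusU σ J : Set ↥(unitaryGroupOfForm σ J)) =
      Subtype.val ⁻¹' {g : GL (Fin N) R | ∀ i j : Fin N, i ≠ j → ((g : GL (Fin N) R) : Matrix (Fin N) (Fin N) R) i j = 0} := by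
    ext g
    rw [SetLike.mem_coe, mem_torusU_iff, Set.mem_preimage, Set.mem_setOf_eq,
      show (∃ d : Fin N → Rˣ, glDiagonal N R d = ((g : ↥(unitaryGroupOfForm σ J)) : GL (Fin N) R)) ↔
          ((g : ↥(unitaryGroupOfForm σ J)) : GL (Fin N) R) ∈ (glDiagonal N R).range from MonoidHom.mem_range.symm,
      mem_range_glDiagonal_iff_isDiag]
    rfl
  rw [hset]
  exact h.preimage continuous_subtype_val

end Generic

/-! ## §2 Diagonal elements of `U(J)(F_v)` with unit entries lie in the level `U(J)(𝒪_v)` -/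

section Level

variable {F E : Type} [Field F] [NumberField F] [Field E] [NumberField E] [Algebra F E] [Algebra.IsQuadraticExtension F E]
  (c : E ≃ₐ[F] E) {N : ℕ} (J : Matrix (Fin N) (Fin N) E) (v : HeightOneSpectrum (𝓞 F))

omit [NumberField F] [Algebra.IsQuadraticExtension F E] in
/-- Entries of the `w`-component of a diagonal `diag(e) ∈ GL_N(E_v)` with `|e_i|_w ≤ 1` are `w`-integral. [cite: PlatonovRapinchuk1994, §5.1] -/
theorem apply_mem_adicCompletionIntegers_of_eq_glDiagonal {g : GL (Fin N) (LocalRing E v)} {e : Fin N → (LocalRing E v)ˣ}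
    (hg : g = glDiagonal N (LocalRing E v) e) (w : PlacesOver E v) (he : ∀ i, Valued.v (((e i : (LocalRing E v)ˣ) : LocalRing E v) w) ≤ 1)
    (i j : Fin N) :
    ((localGLPiEquiv E N v g w : GL (Fin N) (w.1.adicCompletion E)) : Matrix (Fin N) (Fin N) (w.1.adicCompletion E)) i j ∈
      w.1.adicCompletionIntegers E := by
  rw [GLn.coe_piEquiv_apply, Matrix.map_apply, hg, coe_glDiagonal, Matrix.diagonal_apply, HeightOneSpectrum.mem_adicCompletionIntegers,
    Pi.evalRingHom_apply]
  split_ifs with h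
  · subst h
    exact he i
  · rw [Pi.zero_apply, map_zero]
    exact zero_le

omit [Algebra.IsQuadraticExtension F E] in
/-- **A diagonal element `diag(e)` of `U(J)(F_v)` all of whose entries have `|e_i|_w = 1` at every `w ∣ v` lies in the level `U(J)(𝒪_v)`**
(entries of `diag(e)` and of `diag(e)⁻¹ = diag(e⁻¹)` are integral; ★ `mem_localIntegralLevel_iff`, ★ `mem_glInt_adicCompletion_iff`).
[cite: PlatonovRapinchuk1994, §5.1] -/
theorem mem_localIntegralLevel_of_coe_eq_glDiagonal {x : «local» E c N J v} {e : Fin N → (LocalRing E v)ˣ}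
    (hx : (x : GL (Fin N) (LocalRing E v)) = glDiagonal N (LocalRing E v) e)
    (he : ∀ (i : Fin N) (w : PlacesOver E v), Valued.v (((e i : (LocalRing E v)ˣ) : LocalRing E v) w) = 1) :
    x ∈ localIntegralLevel c N J v := by
  rw [mem_localIntegralLevel_iff]
  intro w
  rw [mem_glInt_adicCompletion_iff]
  have hx' : ((x⁻¹ : «local» E c N J v) : GL (Fin N) (LocalRing E v)) = glDiagonal N (LocalRing E v) e⁻¹ := by
    rw [Subgroup.coe_inv, hx, map_inv]
  have hinv : (localGLPiEquiv E N v (x : GL (Fin N) (LocalRing E v)) w)⁻¹ =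
      localGLPiEquiv E N v ((x⁻¹ : «local» E c N J v) : GL (Fin N) (LocalRing E v)) w := by
    rw [Subgroup.coe_inv, map_inv, Pi.inv_apply]
  rw [hinv]
  have he' : ∀ (i : Fin N) (w : PlacesOver E v), Valued.v (((e⁻¹ i : (LocalRing E v)ˣ) : LocalRing E v) w) = 1 := by
    intro i w
    have h1 : Valued.v ((((e i)⁻¹ : (LocalRing E v)ˣ) : LocalRing E v) w) * Valued.v (((e i : (LocalRing E v)ˣ) : LocalRing E v) w) = 1 := by
      rw [← map_mul, ← Pi.mul_apply, ← Units.val_mul, inv_mul_cancel, Units.val_one, Pi.one_apply, map_one]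
    rw [he i w, mul_one] at h1
    exact h1
  exact ⟨fun i j => apply_mem_adicCompletionIntegers_of_eq_glDiagonal v hx w (fun i => (he i w).le) i j,
    fun i j => apply_mem_adicCompletionIntegers_of_eq_glDiagonal v hx' w (fun i => (he' i w).le) i j⟩

end Level

/-! ## §3 The torus of `U(Φ₃)(L⁺_v)` at a non-split place: valuations of the entries, the unit part `t·ʷt`, the split part `t·(ʷt)⁻¹` -/

section CM

variable (L : Type) [Field L] [NumberField L] [IsCMField L] (v : HeightOneSpectrum (𝓞 ↥(maximalRealSubfield L)))

/-- **Valuations on the torus** `t = diag(d₀, d₁, d₂) ∈ T(L⁺_v)`, `v` non-split, `w ∣ v`: `|d₀|_w |d₂|_w = 1` and `|d₁|_w = 1` (the torus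
relations `σ(d₀) d₂ = 1`, `σ(d₁) d₁ = 1` of ★ `HeisRing.torus_relations`, `σ = σ_w` componentwise at a non-split place, `|σ_w ·|_w = |·|_w`).
[cite: Rogawski1990, §1.10 p. 9] [cite: PlatonovRapinchuk1994, §5.1] -/
theorem valued_torus_entries (hns : ∀ w : PlacesOver L v, IsCMField.complexConj L • w.1 = w.1)
    (t : ↥(torusU (conjLocal L (IsCMField.complexConj L) v) (cmLocalForm L 3 v))) {d : Fin 3 → (LocalRing L v)ˣ}
    (hd : glDiagonal 3 (LocalRing L v) d =
      ((t : ↥(unitaryGroupOfForm (conjLocal L (IsCMField.complexConj L) v) (cmLocalForm L 3 v))) : GL (Fin 3) (LocalRing L v)))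
    (w : PlacesOver L v) :
    Valued.v (((d 0 : (LocalRing L v)ˣ) : LocalRing L v) w) * Valued.v (((d 2 : (LocalRing L v)ˣ) : LocalRing L v) w) = 1 ∧
      Valued.v (((d 1 : (LocalRing L v)ˣ) : LocalRing L v) w) = 1 := by
  obtain ⟨-, h11, h02⟩ := HeisRing.torus_relations (conjLocal L (IsCMField.complexConj L) v) (cmLocalForm_eq_over L 3 v) t hd
  have key : ∀ x y : LocalRing L v, conjLocal L (IsCMField.complexConj L) v x * y = 1 →
      Valued.v (x w) * Valued.v (y w) = 1 := by
    intro x y h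
    have hw := congr_fun h w
    rw [Pi.mul_apply, Pi.one_apply, conjLocal_apply_eq_of_smul_eq (IsCMField.complexConj L) (IsCMField.complexConj_ne_one L) v w (hns w)] at hw
    have hv := congrArg Valued.v hw
    rwa [map_mul, valued_galAdicCompletionMap, map_one] at hv
  refine ⟨key _ _ h02, ?_⟩
  have h := key _ _ h11
  rw [← pow_two] at h
  exact le_antisymm ((pow_le_one_iff two_ne_zero).1 h.le) ((one_le_pow_iff two_ne_zero).1 h.ge)

set_option synthInstance.maxHeartbeats 400000 in
set_option maxHeartbeats 1600000 in
/-- **`χ` IS UNITARY ON THE UNIT PART `k = t·ʷt`** of the torus of `U(Φ₃)(L⁺_v)` (`v` non-split; `w₀` of matrix `Φ₃`; `χ : T →* ℂˣ` continuous):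
`t·ʷt = diag(d₀d₂, d₁², d₂d₀)` has entries of `w`-valuation `1` (`valued_torus_entries`), so it lies in the compact open level `U(Φ₃)(𝒪_v)`
(`mem_localIntegralLevel_of_coe_eq_glDiagonal`, ★ `isCompact_localIntegralLevel`), with all its powers; `T` is closed (`isClosed_torusU`); hence
`‖χ(t·ʷt)‖ = 1` (`norm_apply_eq_one_of_pow_mem_isCompact`). [cite: Casselman1995, §4.4 proof of Thm. 4.4.6] [cite: Rogawski1990, §12.2 p. 173] -/
theorem norm_apply_mul_weylConj_eq_one (hns : ∀ w : PlacesOver L v, IsCMField.complexConj L • w.1 = w.1)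
    (w₀ : ↥(unitaryGroupOfForm (conjLocal L (IsCMField.complexConj L) v) (cmLocalForm L 3 v)))
    (hw₀ : Units.val (w₀ : GL (Fin 3) (LocalRing L v)) = cmLocalForm L 3 v)
    (χ : ↥(torusU (conjLocal L (IsCMField.complexConj L) v) (cmLocalForm L 3 v)) →* ℂˣ) (hχ : Continuous fun t => ((χ t : ℂˣ) : ℂ))
    (t : ↥(torusU (conjLocal L (IsCMField.complexConj L) v) (cmLocalForm L 3 v))) :
    ‖((χ (t * ⟨w₀ * (t : ↥(unitaryGroupOfForm (conjLocal L (IsCMField.complexConj L) v) (cmLocalForm L 3 v))) * w₀⁻¹, weylConj_mem_cmTorus L v w₀ hw₀ t⟩) : ℂˣ) : ℂ)‖ = 1 := by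
  obtain ⟨d, hd⟩ := (mem_torusU_iff _).1 t.2
  -- the matrix of `k = t·ʷt` is `diag(d · (d ∘ rev))`
  have hk : (((t * ⟨w₀ * (t : ↥(unitaryGroupOfForm (conjLocal L (IsCMField.complexConj L) v) (cmLocalForm L 3 v))) * w₀⁻¹, weylConj_mem_cmTorus L v w₀ hw₀ t⟩ :
      ↥(torusU (conjLocal L (IsCMField.complexConj L) v) (cmLocalForm L 3 v))) :
        ↥(unitaryGroupOfForm (conjLocal L (IsCMField.complexConj L) v) (cmLocalForm L 3 v))) : GL (Fin 3) (LocalRing L v)) =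
      glDiagonal 3 (LocalRing L v) (d * fun i : Fin 3 => d i.rev) := by
    rw [map_mul, hd, glDiagonal_rev_eq_weylConj (conjLocal L (IsCMField.complexConj L) v) (cmLocalForm_eq_over L 3 v) w₀ hw₀ t hd]
    rfl
  -- its entries have valuation `1` at every `w ∣ v`
  have he : ∀ (i : Fin 3) (w : PlacesOver L v), Valued.v ((((d * fun i : Fin 3 => d i.rev) i : (LocalRing L v)ˣ) : LocalRing L v) w) = 1 := by
    intro i w
    obtain ⟨h02, h1⟩ := valued_torus_entries L v hns t hd w
    rw [Pi.mul_apply, Units.val_mul, Pi.mul_apply, map_mul]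
    fin_cases i
    · exact h02
    · show Valued.v (((d 1 : (LocalRing L v)ˣ) : LocalRing L v) w) * Valued.v (((d 1 : (LocalRing L v)ˣ) : LocalRing L v) w) = 1
      rw [h1, mul_one]
    · show Valued.v (((d 2 : (LocalRing L v)ˣ) : LocalRing L v) w) * Valued.v (((d 0 : (LocalRing L v)ˣ) : LocalRing L v) w) = 1
      rw [mul_comm, h02]
  -- so `k` lies in the compact level `U(Φ₃)(𝒪_v)`
  have hmem := mem_localIntegralLevel_of_coe_eq_glDiagonal (IsCMField.complexConj L)
    (Matrix.of fun i j : Fin 3 => if i.val + j.val + 1 = 3 then (1 : L) else 0) v hk he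
  haveI : T2Space (LocalRing L v) := inferInstance
  refine norm_apply_eq_one_of_pow_mem_isCompact (torusU (conjLocal L (IsCMField.complexConj L) v) (cmLocalForm L 3 v))
    (isClosed_torusU (conjLocal L (IsCMField.complexConj L) v) (cmLocalForm L 3 v)) χ hχ
    (isCompact_localIntegralLevel (IsCMField.complexConj L) 3 (Matrix.of fun i j : Fin 3 => if i.val + j.val + 1 = 3 then (1 : L) else 0) v)
    _ (fun n => ?_) (fun n => ?_)
  · rw [Subgroup.coe_pow]
    exact Subgroup.pow_mem _ hmem n
  · rw [Subgroup.coe_pow, Subgroup.coe_inv]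
    exact Subgroup.pow_mem _ (Subgroup.inv_mem _ hmem) n

set_option synthInstance.maxHeartbeats 400000 in
set_option maxHeartbeats 1600000 in
/-- **The split part `a = t·(ʷt)⁻¹ = diag(d₀ σ(d₀), 1, (d₀ σ(d₀))⁻¹)`** of `t = diag(d₀, d₁, d₂) ∈ T(L⁺_v)`: its first entry `d₀·σ(d₀)` is `σ`-fixed,
its middle entry is `1`, and its modulus is `‖t₀₀‖²` (★ `torusEntry_zero_weylConj`, ★ `unitModulusChar_torusEntry_zero_weylConj`) — i.e. `a` is
an element of Casselman's split cone `A⁻` as typed in ★ `U3SquareIntegrableExponents` whenever `‖t₀₀‖ < 1`. [cite: Casselman1995, §1.4 p. 13; §4.4]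
[cite: Rogawski1990, §1.10 p. 9] -/
theorem splitPart_entries (w₀ : ↥(unitaryGroupOfForm (conjLocal L (IsCMField.complexConj L) v) (cmLocalForm L 3 v)))
    (hw₀ : Units.val (w₀ : GL (Fin 3) (LocalRing L v)) = cmLocalForm L 3 v)
    (t : ↥(torusU (conjLocal L (IsCMField.complexConj L) v) (cmLocalForm L 3 v))) :
    conjLocal L (IsCMField.complexConj L) v
        ((torusEntry (conjLocal L (IsCMField.complexConj L) v) (cmLocalForm L 3 v) 0
          (t * ⟨w₀ * (t : ↥(unitaryGroupOfForm (conjLocal L (IsCMField.complexConj L) v) (cmLocalForm L 3 v))) * w₀⁻¹, weylConj_mem_cmTorus L v w₀ hw₀ t⟩⁻¹) : (LocalRing L v)ˣ) : LocalRing L v) =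
      ((torusEntry (conjLocal L (IsCMField.complexConj L) v) (cmLocalForm L 3 v) 0
          (t * ⟨w₀ * (t : ↥(unitaryGroupOfForm (conjLocal L (IsCMField.complexConj L) v) (cmLocalForm L 3 v))) * w₀⁻¹, weylConj_mem_cmTorus L v w₀ hw₀ t⟩⁻¹) : (LocalRing L v)ˣ) : LocalRing L v) ∧
    torusEntry (conjLocal L (IsCMField.complexConj L) v) (cmLocalForm L 3 v) 1
        (t * ⟨w₀ * (t : ↥(unitaryGroupOfForm (conjLocal L (IsCMField.complexConj L) v) (cmLocalForm L 3 v))) * w₀⁻¹, weylConj_mem_cmTorus L v w₀ hw₀ t⟩⁻¹) = 1 ∧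
    unitModulusChar (LocalRing L v) (torusEntry (conjLocal L (IsCMField.complexConj L) v) (cmLocalForm L 3 v) 0
        (t * ⟨w₀ * (t : ↥(unitaryGroupOfForm (conjLocal L (IsCMField.complexConj L) v) (cmLocalForm L 3 v))) * w₀⁻¹, weylConj_mem_cmTorus L v w₀ hw₀ t⟩⁻¹)) =
      unitModulusChar (LocalRing L v) (torusEntry (conjLocal L (IsCMField.complexConj L) v) (cmLocalForm L 3 v) 0 t) *
        unitModulusChar (LocalRing L v) (torusEntry (conjLocal L (IsCMField.complexConj L) v) (cmLocalForm L 3 v) 0 t) := by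
  obtain ⟨d, hd⟩ := (mem_torusU_iff _).1 t.2
  have h0 := torusEntry_zero_weylConj (conjLocal L (IsCMField.complexConj L) v) (cmLocalForm_eq_over L 3 v) w₀ hw₀ t
  have h1 : torusEntry (conjLocal L (IsCMField.complexConj L) v) (cmLocalForm L 3 v) 1
      ⟨w₀ * (t : ↥(unitaryGroupOfForm (conjLocal L (IsCMField.complexConj L) v) (cmLocalForm L 3 v))) * w₀⁻¹, weylConj_mem_cmTorus L v w₀ hw₀ t⟩ =
        torusEntry (conjLocal L (IsCMField.complexConj L) v) (cmLocalForm L 3 v) 1 t := by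
    rw [torusEntry_eq_of_glDiagonal_eq _ _ 1 _ _
        (glDiagonal_rev_eq_weylConj (conjLocal L (IsCMField.complexConj L) v) (cmLocalForm_eq_over L 3 v) w₀ hw₀ t hd),
      torusEntry_eq_of_glDiagonal_eq _ _ 1 t d hd]
    rfl
  refine ⟨?_, ?_, ?_⟩
  · rw [map_mul, map_inv, h0, inv_inv, Units.val_mul, Units.coe_map, MonoidHom.coe_coe, map_mul, conjLocal_conjLocal_cm, mul_comm]
  · rw [map_mul, map_inv, h1, mul_inv_cancel]
  · letI : MeasurableSpace (LocalRing L v) := borel _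
    haveI : BorelSpace (LocalRing L v) := ⟨rfl⟩
    rw [map_mul, map_inv, map_mul, map_inv, unitModulusChar_torusEntry_zero_weylConj (conjLocal L (IsCMField.complexConj L) v)
      (conjLocal_conjLocal_cm L v) (continuous_conjLocal L (IsCMField.complexConj L) v) (cmLocalForm_eq_over L 3 v) w₀ hw₀ t, inv_inv]

/-- **The Jacquet module of an irreducible smooth representation of `U(Φ₃)(L⁺_v)` is finite-dimensional** as soon as it is non-zero (every finite
`v`): `π` embeds into a principal series `i_G(χ₁, χ₂)` (★ `F0P3JacquetEmbeddingDichotomy`), the Jacquet functor preserves the injection (★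
`jacquetMap_injective`, ★ `isLimitOfCompactOpen_cmBorelTriple_N`), and `r_B i_G(χ)` is `2`-dimensional (★ N1 `U3PrincipalSeriesJacquetFiltration_holds`).
[cite: Casselman1995, Thm. 3.3.1; Thm. 6.3.5] [cite: BernsteinZelevinsky1977, §2.3] -/
theorem finiteDimensional_coinvariants_of_irreducible (hns : ∀ w : PlacesOver L v, IsCMField.complexConj L • w.1 = w.1)
    {V : Type} [AddCommGroup V] [Module ℂ V]
    (π : Representation ℂ ↥(unitaryGroupOfForm (conjLocal L (IsCMField.complexConj L) v) (cmLocalForm L 3 v)) V)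
    (hirr : π.IsIrreducible) (hsm : π.IsSmooth) (hnt : ¬ Subsingleton ((cmBorelTriple L 3 v).restrict π).Coinvariants) :
    FiniteDimensional ℂ ((cmBorelTriple L 3 v).restrict π).Coinvariants := by
  haveI := locallyCompactSpace_cmBorelU L 3 v
  let r : SmoothIrrep (Gqs L v) := { V := V, ρ := π, isIrreducible := hirr, isSmooth := hsm }
  have hD := F0P3JacquetEmbeddingDichotomy.exists_injective_intertwiningMap_cmPrincipalSeries L v r hnt
  refine hD.elim fun χ₁ h₁ => h₁.elim fun χ₂ h₂ => h₂.2.2.elim fun e he => ?_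
  have key := finiteDimensional_finrank_eq_two_of_U3PrincipalSeriesJacquetFiltration L
    (F0P3U3PrincipalSeriesJacquetFiltrationHolds.U3PrincipalSeriesJacquetFiltration_holds L) v hns χ₁ χ₂ h₂.1 h₂.2.1
  haveI := key.1
  have hinj := Representation.jacquetMap_injective (cmBorelTriple L 3 v) (isLimitOfCompactOpen_cmBorelTriple_N L 3 v)
    (F0P3U3LengthLeTwoOfEmbeds.isSmooth_cmPrincipalSeries L v (cmTorusCharPair L v χ₁ χ₂)) e he
  exact Module.Finite.of_injective (Representation.jacquetMap (cmBorelTriple L 3 v) e).toLinearMap hinj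

set_option synthInstance.maxHeartbeats 400000 in
set_option maxHeartbeats 4000000 in
/-- **The decay inequality on the matrix carrier `U(Φ₃)(L⁺_v)`** (all of #110's binders, read over `↥(unitaryGroupOfForm (c ⊗ 1) (cmLocalForm L 3 v))`
— the carrier of every ★ input — so that the letter itself is one `exact` away): given N5 (#109) at `L`, a non-split `v`, an irreducible smooth admissible
`π` square-integrable modulo the centre, a continuous `χ : T →* ℂˣ` with a non-zero `T`-map `π_N → ℂ_χ`, and `t ∈ T` with `‖t₀₀‖ < 1`: `‖χ t‖ < ‖t₀₀‖`.
Steps (D1)–(D4) of the module docstring. [cite: Casselman1995, Thm. 4.4.6; §4.4 p. 45] [cite: Rogawski1990, §12.2 (2) pp. 173–174] -/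
theorem norm_apply_lt_of_quotient_character (hN5 : U3SquareIntegrableExponents L)
    (hns : ∀ w : PlacesOver L v, IsCMField.complexConj L • w.1 = w.1)
    (instM : MeasurableSpace (↥(unitaryGroupOfForm (conjLocal L (IsCMField.complexConj L) v) (cmLocalForm L 3 v)) ⧸ Subgroup.center ↥(unitaryGroupOfForm (conjLocal L (IsCMField.complexConj L) v) (cmLocalForm L 3 v)))) (instB : BorelSpace (↥(unitaryGroupOfForm (conjLocal L (IsCMField.complexConj L) v) (cmLocalForm L 3 v)) ⧸ Subgroup.center ↥(unitaryGroupOfForm (conjLocal L (IsCMField.complexConj L) v) (cmLocalForm L 3 v))))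
    (μZ : MeasureTheory.Measure (↥(unitaryGroupOfForm (conjLocal L (IsCMField.complexConj L) v) (cmLocalForm L 3 v)) ⧸ Subgroup.center ↥(unitaryGroupOfForm (conjLocal L (IsCMField.complexConj L) v) (cmLocalForm L 3 v)))) (instH : μZ.IsHaarMeasure)
    {V : Type} [AddCommGroup V] [Module ℂ V] (π : Representation ℂ ↥(unitaryGroupOfForm (conjLocal L (IsCMField.complexConj L) v) (cmLocalForm L 3 v)) V)
    (hirr : π.IsIrreducible) (hsm : π.IsSmooth) (hadm : π.IsAdmissible) (hL2 : π.IsSquareIntegrableModCenter μZ)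
    (χ : ↥(torusU (conjLocal L (IsCMField.complexConj L) v) (cmLocalForm L 3 v)) →* ℂˣ) (hχc : Continuous fun t => ((χ t : ℂˣ) : ℂ))
    (f : (π.jacquetModule (cmBorelTriple L 3 v)).IntertwiningMap ((Representation.trivial ℂ ↥(torusU (conjLocal L (IsCMField.complexConj L) v) (cmLocalForm L 3 v)) ℂ).twist χ))
    (hf : f.toLinearMap ≠ 0) (t : ↥(torusU (conjLocal L (IsCMField.complexConj L) v) (cmLocalForm L 3 v)))
    (ht : unitModulusChar (LocalRing L v) (torusEntry (conjLocal L (IsCMField.complexConj L) v) (cmLocalForm L 3 v) 0 t) < 1) :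
    ‖((χ t : ℂˣ) : ℂ)‖ <
      ((unitModulusChar (LocalRing L v) (torusEntry (conjLocal L (IsCMField.complexConj L) v) (cmLocalForm L 3 v) 0 t) : ℝ≥0) : ℝ) := by
  haveI := locallyCompactSpace_cmBorelU L 3 v
  haveI : π.IsIrreducible := hirr
  -- (D1) the unitary central character
  refine (F0P3bCentralCharacterUnitaryNonsplit.exists_centralChar_norm_eq_one_of_nonsplit L 3 v hns π hadm).elim fun ω hω => ?_
  -- (D2) the quotient character is a normalised exponent
  have hnt : ¬ Subsingleton ((cmBorelTriple L 3 v).restrict π).Coinvariants := fun hsub =>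
    hf (LinearMap.ext fun x => by rw [Subsingleton.elim x 0, map_zero, LinearMap.zero_apply])
  haveI := finiteDimensional_coinvariants_of_irreducible L v hns π hirr hsm hnt
  have hexp := Representation.hasJacquetExponent_of_quotient_character (ρ := π) (cmBorelTriple L 3 v)
    (torusU_mul_comm (conjLocal L (IsCMField.complexConj L) v) (cmLocalForm L 3 v)) χ f hf
  -- #109, direction ⇒, at the exponent `χ · δ_B^{-1/2}`
  have hdec := (((U3SquareIntegrableExponents_iff L).1 hN5 v hns μZ V π hadm ω hω.1).1 ⟨hω.2, hL2⟩).2 _ hexp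
  -- (D4) the Weyl element, the split part `a = t (ʷt)⁻¹`, the unit part `k = t ʷt`
  refine (F0P3U3PrincipalSeriesOpenCellTorusChar.exists_weylElt_three L v hns).elim fun w₀ hw₀ => ?_
  -- the split part as an ATOMIC torus element `a` (explicit product terms against the binder `↥(cmBorelTriple L 3 v).M` are a
  -- measured heartbeat trap; an atomic variable is not)
  obtain ⟨a, ha_def⟩ : ∃ a : ↥(torusU (conjLocal L (IsCMField.complexConj L) v) (cmLocalForm L 3 v)), a = t * ⟨w₀ * (t : ↥(unitaryGroupOfForm (conjLocal L (IsCMField.complexConj L) v) (cmLocalForm L 3 v))) * w₀⁻¹, weylConj_mem_cmTorus L v w₀ hw₀ t⟩⁻¹ := ⟨_, rfl⟩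
  have hsp := splitPart_entries L v w₀ hw₀ t
  rw [← ha_def] at hsp
  have hu0 : 0 < unitModulusChar (LocalRing L v) (torusEntry (conjLocal L (IsCMField.complexConj L) v) (cmLocalForm L 3 v) 0 t) :=
    MeasureTheory.distribHaarChar_pos
  have hlt : unitModulusChar (LocalRing L v) (torusEntry (conjLocal L (IsCMField.complexConj L) v) (cmLocalForm L 3 v) 0 a) < 1 := by
    rw [hsp.2.2]
    exact mul_lt_one_of_nonneg_of_lt_one_left zero_le ht ht.le
  have ha := hdec _ hsp.1 hsp.2.1 hlt
  -- `‖χ a‖ < δ_B^{1/2}(a) = ‖t₀₀‖²`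
  have hδ : ((rootDeltaChar (cmBorelTriple L 3 v).P (Subgroup.inclusion (cmBorelTriple L 3 v).M_le a) : ℂˣ) : ℂ) =
      ((unitModulusChar (LocalRing L v) (torusEntry (conjLocal L (IsCMField.complexConj L) v) (cmLocalForm L 3 v) 0 a) : ℝ≥0) : ℝ) :=
    F0P2oBorelTorusModulus.rootDeltaChar_cmBorel_torus L v a
  rw [MonoidHom.mul_apply, MonoidHom.inv_apply, MonoidHom.comp_apply, Units.val_mul, norm_mul, Units.val_inv_eq_inv_val, norm_inv, hδ,
    hsp.2.2, Complex.norm_real, NNReal.coe_mul, Real.norm_of_nonneg (mul_nonneg (NNReal.coe_nonneg _) (NNReal.coe_nonneg _)),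
    ← div_eq_mul_inv, div_lt_one (mul_pos (NNReal.coe_pos.2 hu0) (NNReal.coe_pos.2 hu0))] at ha
  -- `‖χ (t ʷt)‖ = 1` and `χ a · χ k = χ t · χ t`
  have hk := norm_apply_mul_weylConj_eq_one L v hns w₀ hw₀ χ hχc t
  have hprod : χ a * χ (t * ⟨w₀ * (t : ↥(unitaryGroupOfForm (conjLocal L (IsCMField.complexConj L) v) (cmLocalForm L 3 v))) * w₀⁻¹, weylConj_mem_cmTorus L v w₀ hw₀ t⟩) = χ t * χ t := by
    rw [ha_def, map_mul, map_mul, map_inv, mul_mul_mul_comm, inv_mul_cancel, mul_one]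
  have hsq : ‖((χ t : ℂˣ) : ℂ)‖ * ‖((χ t : ℂˣ) : ℂ)‖ <
      ((unitModulusChar (LocalRing L v) (torusEntry (conjLocal L (IsCMField.complexConj L) v) (cmLocalForm L 3 v) 0 t) : ℝ≥0) : ℝ) *
        ((unitModulusChar (LocalRing L v) (torusEntry (conjLocal L (IsCMField.complexConj L) v) (cmLocalForm L 3 v) 0 t) : ℝ≥0) : ℝ) := by
    rw [← norm_mul, ← Units.val_mul, ← hprod, Units.val_mul, norm_mul, hk, mul_one]
    exact ha
  exact (mul_self_lt_mul_self_iff (norm_nonneg _) (NNReal.coe_nonneg _)).2 hsq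

set_option synthInstance.maxHeartbeats 400000 in
set_option maxHeartbeats 8000000 in
/-- **#110 ⇐ #109: CASSELMAN'S CRITERION (⇒) IN THE BOREL–JACQUET-QUOTIENT FORM, FROM THE EXPONENT FORM** — the tree's second typing ★
`Rogawski1990.u3_squareIntegrable_jacquetExponent_decay` of [Casselman1995, Thm. 4.4.6 (⇒)] DERIVED from its first typing ★
`UnitaryGroup.U3SquareIntegrableExponents` (N5, #109) at every CM field: `norm_apply_lt_of_quotient_character` read back on the letter's carrier
`Gqs L v = (cmDatum L 3 Φ₃).Local v` (★ `cmDatum_Local_eq`, definitional — the one crossing is this `exact`).  Dictionary: (D1) the central character of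
the irreducible admissible `π` exists and is unitary at a non-split place (★ `exists_centralChar_norm_eq_one_of_nonsplit`); (D2) the non-zero `T`-map
`π_N → ℂ_χ` makes `χ·δ_B^{-1∕2}` an EIGEN-exponent (★ `hasJacquetExponent_of_quotient_character`, `π_N` finite-dimensional by
`finiteDimensional_coinvariants_of_irreducible`, `T` abelian ★ `torusU_mul_comm`); (D3) `δ_B^{1∕2}(a) = ‖a₀₀‖` (★ `rootDeltaChar_cmBorel_torus`); (D4) cone
reduction: for `t` with `‖t₀₀‖ < 1` put `a := t·(ʷt)⁻¹ ∈ A⁻` (`splitPart_entries`) and `k := t·ʷt` (`‖χ k‖ = 1`, `norm_apply_mul_weylConj_eq_one`); then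
`‖χ t‖² = ‖χ a‖·‖χ k‖ = ‖χ a‖ < δ_B^{1∕2}(a) = ‖t₀₀‖²`. [cite: Casselman1995, Thm. 4.4.6; §1.4 p. 13; §4.4 p. 45] [cite: KatoTakano2009, p. 3]
[cite: Rogawski1990, §12.2 (2) pp. 173–174] -/
theorem u3_squareIntegrable_jacquetExponent_decay_of_exponents
    (h : ∀ (L : Type) [Field L] [NumberField L] [IsCMField L], U3SquareIntegrableExponents L) :
    u3_squareIntegrable_jacquetExponent_decay := by
  intro L _ _ _ v hns instM instB μZ instH V _ _ π hirr hsm hadm hL2 χ hχc f hf t ht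
  exact norm_apply_lt_of_quotient_character L v (h L) hns instM instB μZ instH π hirr hsm hadm hL2 χ hχc f hf t ht

/-- **#110 ★ `Rogawski1990.u3_squareIntegrable_jacquetExponent_decay` HOLDS** — Casselman's criterion (⇒) for `U(Φ₃)(L⁺_v)`, `v` non-split, in the
Borel–Jacquet-QUOTIENT form: for an irreducible admissible `π` square-integrable modulo the centre and a non-zero `T`-map `π_N → ℂ_χ`,
`‖χ t‖ < ‖t₀₀‖ = δ_B^{1∕2}(t)` on the cone `‖t₀₀‖ < 1`.  `u3_squareIntegrable_jacquetExponent_decay_of_exponents` fed with the tree's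
hypothesis-free N5 ★ `F0P3U3SquareIntegrableExponentsHolds.u3SquareIntegrableExponents_holds`.
[cite: Casselman1995, Thm. 4.4.6 p. 45] [cite: Rogawski1990, §12.2 (2) pp. 173–174] [cite: KatoTakano2009, p. 3] -/
theorem u3_squareIntegrable_jacquetExponent_decay_holds : u3_squareIntegrable_jacquetExponent_decay :=
  u3_squareIntegrable_jacquetExponent_decay_of_exponents
    fun L _ _ _ => F0P3U3SquareIntegrableExponentsHolds.u3SquareIntegrableExponents_holds L

end CM

end Summit.HodgeConjecture.HodgeConjecture.Cruxes.H413.F0P2oN7OfCasselmanCriterion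

end
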